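import Summits.HubbardSuperconductivity.HubbardSuperconductivity.Theorems.SoloBlindPairTower
import Summits.HubbardSuperconductivity.HubbardSuperconductivity.Theorems.SoloBlindThermalAverage
import HarnessLib

/-!
# Penalty transfer: the "every ground state" clause of `HubbardSuperconductivity` costs nothing

Solo programme `solo-HubbardSuperconductivity-blind`, structural Theorem 17. The summit demands the
d-wave order bound `re ⟨φ, Δ_d†Δ_d φ⟩ ≥ c L⁴` of EVERY unit ground state `φ` of the doped `S^z = 0`
sector of `H_L = hubbardTorus 2 L 1 U` (`hubbardSuperconductivity_iff_uniform_dWave_bound`), and a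
thermal route in the right order of limits reaches only the ground-multiplet AVERAGE (Theorem 10,
`SoloBlindThermalAverage`), so that "every ground state" (uniqueness / rigidity / a degeneracy
bound) looked like an extra debt of every constructive method. It is not: run the method for the
ORDER-PENALISED Hamiltonian `H_L(s) = H_L + s · Δ_d†Δ_d`, ANY `s > 0` (`L`-dependent allowed).

* `re_rayleigh_penalised_minimiser_le` (abstract; `A`, `O` Hermitian, `K` any subspace, `s > 0`):
  a minimiser `φ_s` of the Rayleigh quotient of `A + s O` on `K` has
  `re ⟨φ_s, O φ_s⟩ ≤ re ⟨φ, O φ⟩` for EVERY minimiser `φ` of `A` on `K` — monotonicity of the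
  penalised observable (two applications of the variational principle; no invariance, no gap, no
  non-degeneracy). `groundState_re_rayleigh_ge_of_penalised`: eigenvector form.
* `penalised_minimiser_re_rayleigh_ge_of_certificate` (abstract converse): a certificate
  `a ≤ re⟨φ,Oφ⟩ + κ (re⟨φ,Aφ⟩ - E₀)` on the unit sphere of an invariant `K` and a bound
  `re⟨φ,Oφ⟩ ≤ B` force `re ⟨φ_s, O φ_s⟩ ≥ a/2` on every penalised minimiser once `κ s B ≤ a/2`.
* `hubbardSuperconductivity_of_penalised_groundState` — **THE SUMMIT follows from a SOME-ground-state
  statement**: `U > 0`, `δ ∈ (0,1/2)`, `c > 0`, `L₀` such that at every even side `L ≥ L₀` there are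
  `s > 0` and ONE unit ground state of `H_L + s Δ_d†Δ_d` in the doped sector with d-wave order
  `≥ c L⁴`.
* `penalised_groundState_order_of_hubbardSuperconductivity` — conversely the summit gives, at every
  large even side, an `s > 0` for which the penalised sector ground states exist and ALL have order
  `≥ (c/2) L⁴`; `hubbardSuperconductivity_iff_penalised_groundState` — the equivalence.
* `hubbardSuperconductivity_of_eventually_penalised_thermal` — **Theorem 10 without the rigidity
  clause**: an eventual (in `β`, at fixed `L`) canonical-sector thermal bound
  `re (tr (P_K e^{-βH_L(s)} Δ_d†Δ_d) / tr (P_K e^{-βH_L(s)})) ≥ c L⁴` for the PENALISED Hamiltonian,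
  some `s = s_L > 0`, at every large even `L`, implies `HubbardSuperconductivity` — every ground state
  of the UNPENALISED `H_L`, with the same constant.

Reading. The penalty is positive, of norm `≤ 400 s L⁴`, preserves every symmetry and every
`(N, S^z)` sector, and may be as small as one likes at each side; it suppresses pair order, so order
surviving in ANY ground state (or in the `β → ∞` Gibbs average) of the penalised model bounds the
order of ALL ground states of the model itself. Hence the every-ground-state / uniqueness /
degeneracy issue is NOT an obstruction for any method robust under such a perturbation; the other
requirements (resolution `e^{-2/(αU²)}` per site, `β → ∞` before `L → ∞`, gauge non-invariance,
off-diagonal long range) are untouched. Elementary — the finite-difference form of the concavity of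
the ground energy in a linear coupling / Feynman–Hellmann (as used e.g. by Lieb–Seiringer–Solovej–
Yngvason, *The Mathematics of the Bose Gas and its Condensation* (2005), Ch. 6, p. 46, proof of
Thm 6.2) — the use is the point. [this work]
-/

noncomputable section

namespace Summit.HubbardSuperconductivity.HubbardSuperconductivity.Theorems

open Matrix Filter Topology Literature.Probability.LatticeModels
  Literature.MathematicalPhysics.QuantumLattice
  Literature.MathematicalPhysics.QuantumLattice.EigenvalueContinuation
open scoped ComplexOrder

/-! ### Abstract penalty transfer -/

section Abstract

variable {ι : Type*} [Fintype ι]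

/-- A unit eigenvector at the sector energy has Rayleigh quotient the sector energy. [folklore] -/
theorem re_rayleigh_of_eigen_minEnergyOn {A : Matrix ι ι ℂ} {K : Submodule ℂ (ι → ℂ)}
    {φ : ι → ℂ} (hφ1 : star φ ⬝ᵥ φ = 1) (hφA : A *ᵥ φ = ((A.minEnergyOn K : ℝ) : ℂ) • φ) :
    (star φ ⬝ᵥ A *ᵥ φ).re = A.minEnergyOn K := by
  rw [hφA, dotProduct_smul, hφ1, smul_eq_mul, mul_one, Complex.ofReal_re]

/-- **Penalty transfer (monotonicity of the penalised observable).** `A`, `O` Hermitian, `K` any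
subspace, `s > 0`. If the unit vector `φ_s ∈ K` minimises the Rayleigh quotient of `A + s O` on `K`
and the unit vector `φ ∈ K` minimises that of `A` on `K`, then `re ⟨φ_s, O φ_s⟩ ≤ re ⟨φ, O φ⟩`:
`E(φ_s) + s X(φ_s) ≤ E(φ) + s X(φ) ≤ E(φ_s) + s X(φ)` by the two variational principles
(finite-difference Feynman–Hellmann; Lieb–Seiringer–Solovej–Yngvason 2005, Ch. 6, p. 46).
[folklore] -/
theorem re_rayleigh_penalised_minimiser_le {A O : Matrix ι ι ℂ} (hA : A.IsHermitian)
    (hO : O.IsHermitian) (K : Submodule ℂ (ι → ℂ)) {s : ℝ} (hs : 0 < s)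
    {φs : ι → ℂ} (hφsK : φs ∈ K) (hφs1 : star φs ⬝ᵥ φs = 1)
    (hφsE : (star φs ⬝ᵥ (A + (s : ℂ) • O) *ᵥ φs).re ≤ (A + (s : ℂ) • O).minEnergyOn K)
    {φ : ι → ℂ} (hφK : φ ∈ K) (hφ1 : star φ ⬝ᵥ φ = 1)
    (hφE : (star φ ⬝ᵥ A *ᵥ φ).re ≤ A.minEnergyOn K) :
    (star φs ⬝ᵥ O *ᵥ φs).re ≤ (star φ ⬝ᵥ O *ᵥ φ).re := by
  have hAs : (A + (s : ℂ) • O).IsHermitian := isHermitian_add_ofReal_smul hA hO s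
  have h1 : (A + (s : ℂ) • O).minEnergyOn K ≤ (star φ ⬝ᵥ (A + (s : ℂ) • O) *ᵥ φ).re := by
    have h := minEnergyOn_mul_le_re_rayleigh hAs K hφK
    rwa [hφ1, Complex.one_re, mul_one] at h
  have h2 : A.minEnergyOn K ≤ (star φs ⬝ᵥ A *ᵥ φs).re := by
    have h := minEnergyOn_mul_le_re_rayleigh hA K hφsK
    rwa [hφs1, Complex.one_re, mul_one] at h
  have hsplit : ∀ v : ι → ℂ, (star v ⬝ᵥ (A + (s : ℂ) • O) *ᵥ v).re =
      (star v ⬝ᵥ A *ᵥ v).re + s * (star v ⬝ᵥ O *ᵥ v).re := fun v => by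
    rw [add_mulVec, smul_mulVec, dotProduct_add, dotProduct_smul, Complex.add_re, smul_eq_mul,
      Complex.re_ofReal_mul]
  rw [hsplit] at hφsE h1
  have h3 : s * (star φs ⬝ᵥ O *ᵥ φs).re ≤ s * (star φ ⬝ᵥ O *ᵥ φ).re := by linarith
  exact le_of_mul_le_mul_left h3 hs

/-- **Penalty transfer, eigenvector form.** A unit ground eigenvector `φ_s` of `A + s O` on `K`
(`s > 0`) with `a ≤ re ⟨φ_s, O φ_s⟩` forces `a ≤ re ⟨φ, O φ⟩` on EVERY unit ground eigenvector
`φ` of `A` on `K`. [folklore] -/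
theorem groundState_re_rayleigh_ge_of_penalised {A O : Matrix ι ι ℂ} (hA : A.IsHermitian)
    (hO : O.IsHermitian) (K : Submodule ℂ (ι → ℂ)) {s : ℝ} (hs : 0 < s)
    {φs : ι → ℂ} (hφsK : φs ∈ K) (hφs1 : star φs ⬝ᵥ φs = 1)
    (hφsA : (A + (s : ℂ) • O) *ᵥ φs = (((A + (s : ℂ) • O).minEnergyOn K : ℝ) : ℂ) • φs)
    {a : ℝ} (ha : a ≤ (star φs ⬝ᵥ O *ᵥ φs).re)
    {φ : ι → ℂ} (hφK : φ ∈ K) (hφ1 : star φ ⬝ᵥ φ = 1)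
    (hφA : A *ᵥ φ = ((A.minEnergyOn K : ℝ) : ℂ) • φ) :
    a ≤ (star φ ⬝ᵥ O *ᵥ φ).re :=
  ha.trans (re_rayleigh_penalised_minimiser_le hA hO K hs hφsK hφs1
    (re_rayleigh_of_eigen_minEnergyOn hφs1 hφsA).le hφK hφ1
    (re_rayleigh_of_eigen_minEnergyOn hφ1 hφA).le)

/-- **From a certificate to the penalised minimisers.** `A`, `O` Hermitian, `K ≠ ⊥` invariant
under `A`, `0 ≤ re⟨v, O v⟩` everywhere and `re⟨φ, O φ⟩ ≤ B` on the unit sphere of `K`. If the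
certificate `a ≤ re⟨φ,Oφ⟩ + κ (re⟨φ,Aφ⟩ - minEnergyOn A K)` (`κ ≥ 0`) holds for all unit `φ ∈ K`,
then for every `s > 0` with `κ s B ≤ a/2`, every unit minimiser `φ_s` of `A + s O` on `K` has
`a/2 ≤ re ⟨φ_s, O φ_s⟩`. (Compare `φ_s` with a ground eigenvector `φ₀` of `A`:
`E(φ_s) - E₀ ≤ s (X(φ₀) - X(φ_s)) ≤ s (B - X(φ_s))`, insert in the certificate.) [this work] -/
theorem penalised_minimiser_re_rayleigh_ge_of_certificate {A O : Matrix ι ι ℂ}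
    (hA : A.IsHermitian) (hO : O.IsHermitian) (K : Submodule ℂ (ι → ℂ))
    (hKA : ∀ v ∈ K, A *ᵥ v ∈ K) (hK : K ≠ ⊥)
    (hO0 : ∀ v : ι → ℂ, 0 ≤ (star v ⬝ᵥ O *ᵥ v).re) {B : ℝ}
    (hOB : ∀ φ ∈ K, star φ ⬝ᵥ φ = 1 → (star φ ⬝ᵥ O *ᵥ φ).re ≤ B)
    {a κ : ℝ} (hκ : 0 ≤ κ)
    (hcert : ∀ φ ∈ K, star φ ⬝ᵥ φ = 1 →
      a ≤ (star φ ⬝ᵥ O *ᵥ φ).re + κ * ((star φ ⬝ᵥ A *ᵥ φ).re - A.minEnergyOn K))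
    {s : ℝ} (hs : 0 < s) (hsB : κ * s * B ≤ a / 2)
    {φs : ι → ℂ} (hφsK : φs ∈ K) (hφs1 : star φs ⬝ᵥ φs = 1)
    (hφsE : (star φs ⬝ᵥ (A + (s : ℂ) • O) *ᵥ φs).re ≤ (A + (s : ℂ) • O).minEnergyOn K) :
    a / 2 ≤ (star φs ⬝ᵥ O *ᵥ φs).re := by
  obtain ⟨φ₀, hφ₀K, hφ₀1, hφ₀A⟩ := exists_unit_eigen_minEnergyOn hA K hKA hK
  have hAs : (A + (s : ℂ) • O).IsHermitian := isHermitian_add_ofReal_smul hA hO s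
  have hE₀ : (star φ₀ ⬝ᵥ A *ᵥ φ₀).re = A.minEnergyOn K := re_rayleigh_of_eigen_minEnergyOn hφ₀1 hφ₀A
  have h1 : (A + (s : ℂ) • O).minEnergyOn K ≤ (star φ₀ ⬝ᵥ (A + (s : ℂ) • O) *ᵥ φ₀).re := by
    have h := minEnergyOn_mul_le_re_rayleigh hAs K hφ₀K
    rwa [hφ₀1, Complex.one_re, mul_one] at h
  have hsplit : ∀ v : ι → ℂ, (star v ⬝ᵥ (A + (s : ℂ) • O) *ᵥ v).re =
      (star v ⬝ᵥ A *ᵥ v).re + s * (star v ⬝ᵥ O *ᵥ v).re := fun v => by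
    rw [add_mulVec, smul_mulVec, dotProduct_add, dotProduct_smul, Complex.add_re, smul_eq_mul,
      Complex.re_ofReal_mul]
  rw [hsplit] at hφsE h1
  have hX₀ : s * (star φ₀ ⬝ᵥ O *ᵥ φ₀).re ≤ s * B :=
    mul_le_mul_of_nonneg_left (hOB φ₀ hφ₀K hφ₀1) hs.le
  have hEs : (star φs ⬝ᵥ A *ᵥ φs).re - A.minEnergyOn K ≤
      s * B - s * (star φs ⬝ᵥ O *ᵥ φs).re := by linarith
  have hκEs := mul_le_mul_of_nonneg_left hEs hκ
  have hκsX : 0 ≤ κ * s * (star φs ⬝ᵥ O *ᵥ φs).re :=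
    mul_nonneg (mul_nonneg hκ hs.le) (hO0 φs)
  have hring : κ * (s * B - s * (star φs ⬝ᵥ O *ᵥ φs).re) =
      κ * s * B - κ * s * (star φs ⬝ᵥ O *ᵥ φs).re := by ring
  have hc := hcert φs hφsK hφs1
  linarith

end Abstract

/-! ### The Hubbard torus: penalised Hamiltonians `H_L + s Δ_g†Δ_g` -/

section Hubbard

variable {L : ℕ} [NeZero L]

/-- The order-penalised Hamiltonian `hubbardTorus 2 L t U + s Δ_gᴴΔ_g` maps every joint sector
`(N, S^z = M)` with `N ≥ 2` into itself. [folklore] -/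
theorem penalised_mulVec_mem_szSector (t U s : ℝ) (g : (Fin 2 → ℤ) → ℝ) {N : ℕ} (hN : 2 ≤ N)
    {M : ℝ} {v : Fock (Orb (FermionTorus 2 L))} (hv : v ∈ szSector (Λ := FermionTorus 2 L) N M) :
    (hubbardTorus 2 L t U + (s : ℂ) • ((pairField g L)ᴴ * pairField g L)) *ᵥ v ∈
      szSector (Λ := FermionTorus 2 L) N M := by
  rw [add_mulVec, smul_mulVec]
  refine Submodule.add_mem _ (hubbardTorus_mulVec_mem_szSector t U hv) (Submodule.smul_mem _ _ ?_)
  rw [← mulVec_mulVec]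
  have h := PairTower.pairField_conjTranspose_mulVec_mem_szSector g
    (PairTower.pairField_mulVec_mem_szSector g hv)
  rwa [Nat.sub_add_cancel hN] at h

/-- The penalised Hamiltonian is Hermitian. [folklore] -/
theorem isHermitian_penalised (t U s : ℝ) (g : (Fin 2 → ℤ) → ℝ) :
    (hubbardTorus 2 L t U + (s : ℂ) • ((pairField g L)ᴴ * pairField g L)).IsHermitian :=
  isHermitian_add_ofReal_smul (isHermitian_hubbardTorus L t U)
    (isHermitian_conjTranspose_mul_self _) s

/-- The doped particle number `2⌊(1-δ)L²/2⌋` is at least `2` once `L ≥ 2` and `δ < 1/2`.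
[folklore] -/
theorem two_le_dopedN {δ : ℝ} (hδ : δ < 1 / 2) {L : ℕ} (hL : 2 ≤ L) :
    2 ≤ 2 * ⌊(1 - δ) * (L : ℝ) ^ 2 / 2⌋₊ := by
  have hL' : (2 : ℝ) ≤ (L : ℝ) := by exact_mod_cast hL
  have h1 : (1 : ℝ) ≤ (1 - δ) * (L : ℝ) ^ 2 / 2 := by nlinarith
  have h2 : 1 ≤ ⌊(1 - δ) * (L : ℝ) ^ 2 / 2⌋₊ := by
    rw [Nat.one_le_floor_iff]
    exact h1
  omega

/-- At an even side `L = n+1` with `δ ∈ (0,1/2)` the doped sector has `N ≥ 2` particles and is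
non-trivial (it contains a ground state of the Hubbard Hamiltonian). [folklore] -/
theorem dopedSector_two_le_and_ne_bot (U : ℝ) {δ : ℝ} (hδ : δ ∈ Set.Ioo (0 : ℝ) (1 / 2))
    {n : ℕ} (hn : Even (n + 1)) :
    2 ≤ 2 * ⌊(1 - δ) * ((n + 1 : ℕ) : ℝ) ^ 2 / 2⌋₊ ∧
      szSector (Λ := FermionTorus 2 (n + 1)) (2 * ⌊(1 - δ) * ((n + 1 : ℕ) : ℝ) ^ 2 / 2⌋₊) 0
        ≠ ⊥ := by
  have hL2 : 2 ≤ n + 1 := by obtain ⟨k, hk⟩ := hn; omega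
  refine ⟨two_le_dopedN hδ.2 hL2, ?_⟩
  obtain ⟨ψ, -, hgs⟩ :=
    InfVolFermionState.exists_unit_isGroundStateInSector_rectN (1 : ℝ) U (n := 1 - δ)
      (by linarith [hδ.1]) (n + 1)
  have hgs' : IsGroundStateInSector (hubbardTorus 2 (n + 1) 1 U)
      (2 * ⌊(1 - δ) * ((n + 1 : ℕ) : ℝ) ^ 2 / 2⌋₊) 0 ψ := by
    simpa [ThermodynamicLimit.rectN] using hgs
  exact (Submodule.ne_bot_iff _).2 ⟨ψ, hgs'.1, hgs'.2.1⟩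

end Hubbard

/-! ### The summit and the penalised model -/

section Summit

/-- **Theorem 17 (sufficiency): SOME penalised ground state gives EVERY ground state, hence the
summit.** If for some `U > 0`, `δ ∈ (0,1/2)`, `c > 0`, `L₀`, at every even side `L = n+1 ≥ L₀`
there are `s > 0` and a unit ground state `φ_s` of `hubbardTorus 2 L 1 U + s (√2Δ_d)†(√2Δ_d)` in
the sector `(2⌊(1-δ)L²/2⌋, S^z = 0)` with `c L⁴ ≤ re ⟨φ_s, (√2Δ_d)†(√2Δ_d) φ_s⟩`, then
`HubbardSuperconductivity`. [this work] -/
theorem hubbardSuperconductivity_of_penalised_groundState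
    (h : ∃ U : ℝ, 0 < U ∧ ∃ δ ∈ Set.Ioo (0 : ℝ) (1 / 2), ∃ c : ℝ, 0 < c ∧ ∃ L₀ : ℕ,
      ∀ n : ℕ, Even (n + 1) → L₀ ≤ n + 1 → ∃ s : ℝ, 0 < s ∧
        ∃ φ : Fock (Orb (FermionTorus 2 (n + 1))), star φ ⬝ᵥ φ = 1 ∧
          IsGroundStateInSector
              (hubbardTorus 2 (n + 1) 1 U + (s : ℂ) •
                ((pairField dWaveFormFactor (n + 1))ᴴ * pairField dWaveFormFactor (n + 1)))
              (2 * ⌊(1 - δ) * ((n + 1 : ℕ) : ℝ) ^ 2 / 2⌋₊) 0 φ ∧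
            c * ((n + 1 : ℕ) : ℝ) ^ 4 ≤
              (expect ((pairField dWaveFormFactor (n + 1))ᴴ * pairField dWaveFormFactor (n + 1))
                φ).re) :
    HubbardSuperconductivity := by
  obtain ⟨U, hU, δ, hδ, c, hc, L₀, hb⟩ := h
  refine hubbardSuperconductivity_of_uniform_dWave_bound
    ⟨U, hU, δ, hδ, c, hc, L₀, fun n hn hL φ hφ1 hgs => ?_⟩
  obtain ⟨s, hs, φs, hφs1, hφs, hord⟩ := hb n hn hL
  exact groundState_re_rayleigh_ge_of_penalised (isHermitian_hubbardTorus (n + 1) 1 U)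
    (isHermitian_conjTranspose_mul_self _) _ hs hφs.1 hφs1 hφs.2.2 hord hgs.1 hφ1 hgs.2.2

/-- **Theorem 17 (necessity): the summit makes ALL ground states of a suitably penalised model
ordered.** `HubbardSuperconductivity` ⟹ for some `U > 0`, `δ ∈ (0,1/2)`, `c > 0`, `L₀`, at every
even side `L = n+1 ≥ L₀` there is `s > 0` such that the penalised Hamiltonian
`hubbardTorus 2 L 1 U + s (√2Δ_d)†(√2Δ_d)` HAS a unit ground state in the doped sector and EVERY
such ground state has `c L⁴ ≤ re ⟨φ, (√2Δ_d)†(√2Δ_d) φ⟩` (from the certificate form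
`hubbardSuperconductivity_iff_certificate` with multiplier `κ_L`, taking `s = c/(800(κ_L+1))` and
the operator bound `re⟨Δ_d φ, Δ_d φ⟩ ≤ 400 L⁴`). [this work] -/
theorem penalised_groundState_order_of_hubbardSuperconductivity (hS : HubbardSuperconductivity) :
    ∃ U : ℝ, 0 < U ∧ ∃ δ ∈ Set.Ioo (0 : ℝ) (1 / 2), ∃ c : ℝ, 0 < c ∧ ∃ L₀ : ℕ,
      ∀ n : ℕ, Even (n + 1) → L₀ ≤ n + 1 → ∃ s : ℝ, 0 < s ∧
        (∃ φ : Fock (Orb (FermionTorus 2 (n + 1))), star φ ⬝ᵥ φ = 1 ∧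
          IsGroundStateInSector
              (hubbardTorus 2 (n + 1) 1 U + (s : ℂ) •
                ((pairField dWaveFormFactor (n + 1))ᴴ * pairField dWaveFormFactor (n + 1)))
              (2 * ⌊(1 - δ) * ((n + 1 : ℕ) : ℝ) ^ 2 / 2⌋₊) 0 φ) ∧
        ∀ φ : Fock (Orb (FermionTorus 2 (n + 1))), star φ ⬝ᵥ φ = 1 →
          IsGroundStateInSector
              (hubbardTorus 2 (n + 1) 1 U + (s : ℂ) •
                ((pairField dWaveFormFactor (n + 1))ᴴ * pairField dWaveFormFactor (n + 1)))
              (2 * ⌊(1 - δ) * ((n + 1 : ℕ) : ℝ) ^ 2 / 2⌋₊) 0 φ →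
            c * ((n + 1 : ℕ) : ℝ) ^ 4 ≤
              (expect ((pairField dWaveFormFactor (n + 1))ᴴ * pairField dWaveFormFactor (n + 1))
                φ).re := by
  obtain ⟨U, hU, δ, hδ, c, hc, L₀, hb⟩ := hubbardSuperconductivity_iff_certificate.mp hS
  refine ⟨U, hU, δ, hδ, c / 2, by positivity, L₀, fun n hn hL => ?_⟩
  obtain ⟨κ, hκ, hcert⟩ := hb n hn hL
  obtain ⟨hN2, hKne⟩ := dopedSector_two_le_and_ne_bot U hδ hn
  set N : ℕ := 2 * ⌊(1 - δ) * ((n + 1 : ℕ) : ℝ) ^ 2 / 2⌋₊ with hN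
  set K : Submodule ℂ (Fock (Orb (FermionTorus 2 (n + 1)))) := szSector N 0 with hK
  set H := hubbardTorus 2 (n + 1) 1 U with hH
  set O := (pairField dWaveFormFactor (n + 1))ᴴ * pairField dWaveFormFactor (n + 1) with hO
  set s : ℝ := c / (800 * (κ + 1)) with hs_def
  have hκ1 : 0 < κ + 1 := by linarith
  have hs : 0 < s := by rw [hs_def]; positivity
  have hHs : (H + (s : ℂ) • O).IsHermitian := isHermitian_penalised 1 U s dWaveFormFactor
  have hinv : ∀ v ∈ K, (H + (s : ℂ) • O) *ᵥ v ∈ K := fun v hv =>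
    penalised_mulVec_mem_szSector 1 U s dWaveFormFactor hN2 hv
  refine ⟨s, hs, ?_, ?_⟩
  · obtain ⟨φ, hφK, hφ1, hφA⟩ := exists_unit_eigen_minEnergyOn hHs K hinv hKne
    exact ⟨φ, hφ1, hφK, fun h0 => by simp [h0] at hφ1, hφA⟩
  · intro φ hφ1 hgs
    have hB : ∀ ψ ∈ K, star ψ ⬝ᵥ ψ = 1 → (star ψ ⬝ᵥ O *ᵥ ψ).re ≤ 400 * ((n + 1 : ℕ) : ℝ) ^ 4 := by
      intro ψ _ hψ1
      have h := pairField_order_le dWaveFormFactor GaugeTwist.abs_dWaveFormFactor_le_one ψ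
      rw [hψ1, Complex.one_re, mul_one] at h
      rwa [hO, ← mulVec_mulVec, dotProduct_mulVec, ← star_mulVec]
    have hsB : κ * s * (400 * ((n + 1 : ℕ) : ℝ) ^ 4) ≤ c * ((n + 1 : ℕ) : ℝ) ^ 4 / 2 := by
      rw [hs_def]
      have hL4 : (0 : ℝ) ≤ ((n + 1 : ℕ) : ℝ) ^ 4 := by positivity
      have hfrac : κ / (κ + 1) ≤ 1 := by
        rw [div_le_one hκ1]; linarith
      have : κ * (c / (800 * (κ + 1))) * (400 * ((n + 1 : ℕ) : ℝ) ^ 4) =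
          κ / (κ + 1) * (c * ((n + 1 : ℕ) : ℝ) ^ 4 / 2) := by
        field_simp
        ring
      rw [this]
      have hc4 : 0 ≤ c * ((n + 1 : ℕ) : ℝ) ^ 4 / 2 := by positivity
      calc κ / (κ + 1) * (c * ((n + 1 : ℕ) : ℝ) ^ 4 / 2)
          ≤ 1 * (c * ((n + 1 : ℕ) : ℝ) ^ 4 / 2) := mul_le_mul_of_nonneg_right hfrac hc4
        _ = c * ((n + 1 : ℕ) : ℝ) ^ 4 / 2 := one_mul _
    have key := penalised_minimiser_re_rayleigh_ge_of_certificate (isHermitian_hubbardTorus (n + 1) 1 U)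
      (isHermitian_conjTranspose_mul_self _) K (fun v hv => hubbardTorus_mulVec_mem_szSector 1 U hv)
      hKne (fun v => re_expect_pairField_nonneg dWaveFormFactor n v) hB hκ hcert hs hsB hgs.1 hφ1
      (re_rayleigh_of_eigen_minEnergyOn hφ1 hgs.2.2).le
    have : c / 2 * ((n + 1 : ℕ) : ℝ) ^ 4 = c * ((n + 1 : ℕ) : ℝ) ^ 4 / 2 := by ring
    rw [this]
    exact key

/-- **Theorem 17: `HubbardSuperconductivity` is equivalent to a SOME-ground-state statement for the
order-penalised model.** The summit holds iff for some `U > 0`, `δ ∈ (0,1/2)`, `c > 0`, `L₀`, at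
every even side `L = n+1 ≥ L₀` there are `s > 0` and ONE unit ground state of
`hubbardTorus 2 L 1 U + s (√2Δ_d)†(√2Δ_d)` in the sector `(2⌊(1-δ)L²/2⌋, S^z = 0)` whose d-wave
order is `≥ c L⁴`. The every-ground-state clause of the summit has disappeared. [this work] -/
theorem hubbardSuperconductivity_iff_penalised_groundState :
    HubbardSuperconductivity ↔
      ∃ U : ℝ, 0 < U ∧ ∃ δ ∈ Set.Ioo (0 : ℝ) (1 / 2), ∃ c : ℝ, 0 < c ∧ ∃ L₀ : ℕ,
        ∀ n : ℕ, Even (n + 1) → L₀ ≤ n + 1 → ∃ s : ℝ, 0 < s ∧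
          ∃ φ : Fock (Orb (FermionTorus 2 (n + 1))), star φ ⬝ᵥ φ = 1 ∧
            IsGroundStateInSector
                (hubbardTorus 2 (n + 1) 1 U + (s : ℂ) •
                  ((pairField dWaveFormFactor (n + 1))ᴴ * pairField dWaveFormFactor (n + 1)))
                (2 * ⌊(1 - δ) * ((n + 1 : ℕ) : ℝ) ^ 2 / 2⌋₊) 0 φ ∧
              c * ((n + 1 : ℕ) : ℝ) ^ 4 ≤
                (expect ((pairField dWaveFormFactor (n + 1))ᴴ * pairField dWaveFormFactor (n + 1))
                  φ).re := by
  constructor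
  · intro hS
    obtain ⟨U, hU, δ, hδ, c, hc, L₀, hb⟩ := penalised_groundState_order_of_hubbardSuperconductivity hS
    refine ⟨U, hU, δ, hδ, c, hc, L₀, fun n hn hL => ?_⟩
    obtain ⟨s, hs, ⟨φ, hφ1, hφ⟩, hall⟩ := hb n hn hL
    exact ⟨s, hs, φ, hφ1, hφ, hall φ hφ1 hφ⟩
  · exact hubbardSuperconductivity_of_penalised_groundState

/-- **Theorem 17 (thermal form): Theorem 10 without the rigidity clause.** If for some `U > 0`,
`δ ∈ (0,1/2)`, `c > 0`, `L₀`, at every even side `L = n+1 ≥ L₀` there is `s > 0` such that the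
canonical Gibbs state of the doped sector for the PENALISED Hamiltonian `H_L(s) = H_L + s Δ_d†Δ_d`
satisfies `c L⁴ ≤ re (tr (P_K e^{-βH_L(s)} Δ_d†Δ_d) / tr (P_K e^{-βH_L(s)}))` for all large `β`
(depending on `L`), then `HubbardSuperconductivity`: EVERY ground state of the UNPENALISED `H_L`
has d-wave order `≥ c L⁴`. No uniqueness, rigidity or degeneracy input. [this work] -/
theorem hubbardSuperconductivity_of_eventually_penalised_thermal
    (h : ∃ U : ℝ, 0 < U ∧ ∃ δ ∈ Set.Ioo (0 : ℝ) (1 / 2), ∃ c : ℝ, 0 < c ∧ ∃ L₀ : ℕ,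
      ∀ n : ℕ, Even (n + 1) → L₀ ≤ n + 1 → ∃ s : ℝ, 0 < s ∧
        ∀ᶠ β : ℝ in atTop, c * ((n + 1 : ℕ) : ℝ) ^ 4 ≤
          ((projMatrix ((szSector (Λ := FermionTorus 2 (n + 1))
                (2 * ⌊(1 - δ) * ((n + 1 : ℕ) : ℝ) ^ 2 / 2⌋₊) 0).map
                ((WithLp.linearEquiv 2 ℂ (Fock (Orb (FermionTorus 2 (n + 1))))).symm :
                  Fock (Orb (FermionTorus 2 (n + 1))) →ₗ[ℂ]
                    EuclideanSpace ℂ (Finset (Orb (FermionTorus 2 (n + 1)))))) *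
              gibbsWeight β (hubbardTorus 2 (n + 1) 1 U + (s : ℂ) •
                ((pairField dWaveFormFactor (n + 1))ᴴ * pairField dWaveFormFactor (n + 1))) *
              ((pairField dWaveFormFactor (n + 1))ᴴ * pairField dWaveFormFactor (n + 1))).trace /
            (projMatrix ((szSector (Λ := FermionTorus 2 (n + 1))
                (2 * ⌊(1 - δ) * ((n + 1 : ℕ) : ℝ) ^ 2 / 2⌋₊) 0).map
                ((WithLp.linearEquiv 2 ℂ (Fock (Orb (FermionTorus 2 (n + 1))))).symm :
                  Fock (Orb (FermionTorus 2 (n + 1))) →ₗ[ℂ]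
                    EuclideanSpace ℂ (Finset (Orb (FermionTorus 2 (n + 1)))))) *
              gibbsWeight β (hubbardTorus 2 (n + 1) 1 U + (s : ℂ) •
                ((pairField dWaveFormFactor (n + 1))ᴴ * pairField dWaveFormFactor (n + 1)))).trace).re) :
    HubbardSuperconductivity := by
  obtain ⟨U, hU, δ, hδ, c, hc, L₀, hb⟩ := h
  refine hubbardSuperconductivity_of_penalised_groundState
    ⟨U, hU, δ, hδ, c, hc, L₀, fun n hn hL => ?_⟩
  obtain ⟨s, hs, hth⟩ := hb n hn hL
  obtain ⟨hN2, hKne⟩ := dopedSector_two_le_and_ne_bot U hδ hn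
  set N : ℕ := 2 * ⌊(1 - δ) * ((n + 1 : ℕ) : ℝ) ^ 2 / 2⌋₊ with hN
  set K : Submodule ℂ (Fock (Orb (FermionTorus 2 (n + 1)))) := szSector N 0 with hK
  set H := hubbardTorus 2 (n + 1) 1 U with hH
  set O := (pairField dWaveFormFactor (n + 1))ᴴ * pairField dWaveFormFactor (n + 1) with hO
  have hHs : (H + (s : ℂ) • O).IsHermitian := isHermitian_penalised 1 U s dWaveFormFactor
  have hinv : ∀ v ∈ K, (H + (s : ℂ) • O) *ᵥ v ∈ K := fun v hv =>
    penalised_mulVec_mem_szSector 1 U s dWaveFormFactor hN2 hv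
  have hE₀ := inf_eigenspace_minEnergyOn_ne_bot hHs K hinv hKne
  obtain ⟨φ, hφV, hφ0, hφ⟩ := exists_groundState_order_of_eventually_sectorGibbs hHs K hinv hE₀ O
    (c * ((n + 1 : ℕ) : ℝ) ^ 4) hth
  obtain ⟨r, hr, hrr, hr1⟩ := exists_normalize hφ0
  have hφK : φ ∈ K := (Submodule.mem_inf.1 hφV).1
  have hφA : (H + (s : ℂ) • O) *ᵥ φ = ((((H + (s : ℂ) • O).minEnergyOn K : ℝ) : ℂ)) • φ := by
    have h := Module.End.mem_eigenspace_iff.1 (Submodule.mem_inf.1 hφV).2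
    rwa [Matrix.toLin'_apply] at h
  refine ⟨s, hs, (r : ℂ) • φ, hr1, ⟨K.smul_mem _ hφK, fun h0 => by simp [h0] at hr1, ?_⟩, ?_⟩
  · rw [mulVec_smul, hφA, smul_comm]
  · change c * ((n + 1 : ℕ) : ℝ) ^ 4 ≤ (star ((r : ℂ) • φ) ⬝ᵥ (O *ᵥ ((r : ℂ) • φ))).re
    rw [mulVec_smul, star_real_smul_dotProduct_real_smul, Complex.re_ofReal_mul]
    have h1 : c * ((n + 1 : ℕ) : ℝ) ^ 4 = r * r * (c * ((n + 1 : ℕ) : ℝ) ^ 4 * (star φ ⬝ᵥ φ).re) := by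
      calc c * ((n + 1 : ℕ) : ℝ) ^ 4 = c * ((n + 1 : ℕ) : ℝ) ^ 4 * (r * r * (star φ ⬝ᵥ φ).re) := by
            rw [hrr, mul_one]
        _ = r * r * (c * ((n + 1 : ℕ) : ℝ) ^ 4 * (star φ ⬝ᵥ φ).re) := by ring
    rw [h1]
    exact mul_le_mul_of_nonneg_left hφ (mul_self_nonneg r)

end Summit

end Summit.HubbardSuperconductivity.HubbardSuperconductivity.Theorems

end
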